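import Summits.BirchSwinnertonDyer.Rank1Residual.Supersingular.TamParityChi8Link
import Literature.NumberTheory.NumberFields.CubicFieldExplicit
import Literature.Barriers.BirchSwinnertonDyer.RankNotSumOfLocalInvariantsF3CubicPolys
import HarnessLib

/-!
# Arithmetic of a curve with good supersingular reduction at `2`

Route `ResidualThetaTransportAtTwo`, crux K0⁺ `HeckeThetaPartnerAdicAtTwo` (stmt-BirchSwinnertonDyer-20690),
helper §A/§B of the line "proof from print".  THEOREMS ONLY (no definition, no named fact, no `sorry`).

For a globally minimal `W/ℚ` with good supersingular reduction at `2` (`GoodSS W 2`: good at `2`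
and `2 ∣ a₂`; then `a₁` is even and `a₃` odd on the minimal equation, and `Δ_min ≡ 5 (mod 8)` —
tree theorems `even_a₁_and_odd_a₃_of_goodSS_two`, `minimalDiscriminantInt_emod_eight_eq_five_of_goodSS_two`
of `Summits/BirchSwinnertonDyer/Rank1Residual/Supersingular/TamParityChi8Link.lean`):
* `disc_twoDivisionCubic` — the monic integral 2-division cubic `h_W = X³ + b₂X² + 8b₄X + 16b₆`
  (`= 16 ψ₂(X/4)`, the tree's `MonicCubic.poly b₂ (8b₄) (16b₆)`) has `disc(h_W) = 256 Δ_min`;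
* `irreducible_twoDivisionCubic_of_goodSS` — `h_W` is irreducible over `ℚ` (an integer root `n` has
  `n` even, `n/2` even, and then `b₆` even).
-/

set_option autoImplicit false
set_option linter.dupNamespace false

noncomputable section

open WeierstrassCurve Polynomial
open Literature.NumberTheory.EllipticCurves Literature.NumberTheory.EllipticCurves.Rank1Residual
  Literature.NumberTheory.NumberFields

namespace Summit.BirchSwinnertonDyer.BirchSwinnertonDyer.Theorems.HeckeThetaPartner

section Curve

variable (W : WeierstrassCurve ℚ) [W.IsGloballyMinimal]

/-! ### The monic integral 2-division cubic `h_W = X³ + b₂X² + 8b₄X + 16b₆` -/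

/-- **`disc(h_W) = 256 · Δ_min`** (`h_W(X) = 16 ψ₂(X/4)` with `disc ψ₂ = 16Δ`; here as the polynomial
identity using `4b₈ = b₂b₆ − b₄²`). [folklore] -/
theorem disc_twoDivisionCubic :
    MonicCubic.disc (integralModelInt W).b₂ (8 * (integralModelInt W).b₄) (16 * (integralModelInt W).b₆) =
      256 * minimalDiscriminantInt W := by
  rw [minimalDiscriminantInt, MonicCubic.disc, WeierstrassCurve.Δ]
  have hb := (integralModelInt W).b_relation
  linear_combination (64 * (integralModelInt W).b₂ ^ 2) * hb

/-- **`h_W` is irreducible over `ℚ`** when `W` is good supersingular at `2`: with `a₁ = 2s`, `a₃` odd,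
`h_W = X³ + 4βX² + 16γX + 16b₆` (`β = s² + a₂`, `γ = a₄ + s a₃`, `b₆` odd); an integer root `n` is
even, `n = 2m` gives `m³ + 2βm² + 4γ m + 2b₆ = 0`, so `m = 2u` and `4u³ + 4βu² + 4γu + b₆ = 0`,
contradicting `b₆` odd. [folklore] -/
theorem irreducible_twoDivisionCubic_of_goodSS (hss : GoodSS W 2) :
    Irreducible (MonicCubic.polyQ (integralModelInt W).b₂ (8 * (integralModelInt W).b₄)
      (16 * (integralModelInt W).b₆)) := by
  obtain ⟨⟨s, hs⟩, ⟨r, hr⟩⟩ :=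
    Summit.BirchSwinnertonDyer.Rank1Residual.Supersingular.even_a₁_and_odd_a₃_of_goodSS_two W hss.1 hss.2
  set V := integralModelInt W with hV
  have hb₂ : V.b₂ = 4 * (s ^ 2 + V.a₂) := by rw [WeierstrassCurve.b₂, hs]; ring
  have hb₄ : V.b₄ = 2 * (V.a₄ + s * V.a₃) := by rw [WeierstrassCurve.b₄, hs]; ring
  have hb₆ : V.b₆ = 4 * (r ^ 2 + r) + 1 + 4 * V.a₆ := by rw [WeierstrassCurve.b₆, hr]; ring
  rw [MonicCubic.polyQ_eq]
  refine Literature.Barriers.BirchSwinnertonDyer.DokchitserDokchitser2011.irreducible_cubic_of_forall_int_dvd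
    fun n _ hn => ?_
  rw [hb₂, hb₄, hb₆] at hn
  set β := s ^ 2 + V.a₂
  set γ := V.a₄ + s * V.a₃
  set a := V.a₆
  set q := r ^ 2 + r
  -- `n` is even
  rcases Int.even_or_odd n with ⟨m, rfl⟩ | ⟨m, rfl⟩
  · -- `n = 2m`: `m³ + 2βm² + 4γm + 2b₆ = 0`, so `m` is even
    have h1 : m ^ 3 + 2 * β * m ^ 2 + 4 * γ * m + 2 * (4 * q + 1 + 4 * a) = 0 := by
      have : (m + m) ^ 3 + 4 * β * (m + m) ^ 2 + 8 * (2 * γ) * (m + m) + 16 * (4 * q + 1 + 4 * a) =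
          8 * (m ^ 3 + 2 * β * m ^ 2 + 4 * γ * m + 2 * (4 * q + 1 + 4 * a)) := by ring
      rw [this] at hn
      omega
    rcases Int.even_or_odd m with ⟨u, rfl⟩ | ⟨u, rfl⟩
    · have : (u + u) ^ 3 + 2 * β * (u + u) ^ 2 + 4 * γ * (u + u) + 2 * (4 * q + 1 + 4 * a) =
          8 * (u ^ 3 + β * u ^ 2 + γ * u + q + a) + 2 := by ring
      rw [this] at h1
      omega
    · have : (2 * u + 1) ^ 3 + 2 * β * (2 * u + 1) ^ 2 + 4 * γ * (2 * u + 1) + 2 * (4 * q + 1 + 4 * a) =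
          2 * (4 * u ^ 3 + 6 * u ^ 2 + 3 * u + β * (2 * u + 1) ^ 2 + 2 * γ * (2 * u + 1) + 4 * q + 1 + 4 * a) + 1 := by
        ring
      rw [this] at h1
      omega
  · have : (2 * m + 1) ^ 3 + 4 * β * (2 * m + 1) ^ 2 + 8 * (2 * γ) * (2 * m + 1) + 16 * (4 * q + 1 + 4 * a) =
        2 * (4 * m ^ 3 + 6 * m ^ 2 + 3 * m + 2 * β * (2 * m + 1) ^ 2 + 8 * γ * (2 * m + 1) +
          8 * (4 * q + 1 + 4 * a)) + 1 := by ring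
    rw [this] at hn
    omega

end Curve

end Summit.BirchSwinnertonDyer.BirchSwinnertonDyer.Theorems.HeckeThetaPartner

end
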